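import Literature.Analysis.FluidPDE.NSLocalLerayFarFieldRegularSlabProofs
import Literature.Analysis.FluidPDE.NSBoundedHigherRegularityQuantProofs
import Literature.Analysis.FluidPDE.LocalLerayPressureBoundHolds
import HarnessLib

/-!
# Serrin's far-field regularity with the vorticity equation for slab local Leray solutions — holds

Analysis/FluidPDE proofs file (theorems only). The discharge of the named fact
`localLeray_exterior_vorticity_regular_of_bounded_slab` (`NSLocalLerayFarFieldRegularSlab.lean`;
Lemarié-Rieusset 2016, Thm. 15.4, proof, Steps 2–3, PDF p. 569, with Thm. 13.1): the reduction
`localLeray_exterior_vorticity_regular_of_bounded_slab_of_facts`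
(`NSLocalLerayFarFieldRegularSlabProofs.lean`) fed with the two inputs, now theorems:
the quantitative higher interior regularity of bounded distributional solutions
`NSBoundedHigherRegularityBounds_holds` (`NSBoundedHigherRegularityQuantProofs.lean`, the Serrin
bootstrap of the `NSBootstrap*` files) and the local pressure bound
`kangMiuraTsai_local_pressure_bound_holds` (`LocalLerayPressureBoundHolds.lean`).

## References

* P. G. Lemarié-Rieusset, *The Navier–Stokes Problem in the 21st Century* (2016), Thm. 15.4,
  proof, Steps 2–3 (PDF p. 569); Thm. 13.1. [`LemarieRieusset2016`]
-/

noncomputable section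

namespace Literature.Analysis.FluidPDE

/-- **Serrin's far-field regularity with the vorticity equation for slab local Leray solutions
holds** (Lemarié-Rieusset 2016, Thm. 15.4, proof, Steps 2–3 (PDF p. 569), with Thm. 13.1):
from `localLeray_exterior_vorticity_regular_of_bounded_slab_of_facts`,
`NSBoundedHigherRegularityBounds_holds` and `kangMiuraTsai_local_pressure_bound_holds`.
[cite: LemarieRieusset2016, Thm. 15.4, proof, Steps 2–3 (PDF p. 569)] -/
theorem localLeray_exterior_vorticity_regular_of_bounded_slab_holds :
    localLeray_exterior_vorticity_regular_of_bounded_slab :=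
  localLeray_exterior_vorticity_regular_of_bounded_slab_of_facts NSBoundedHigherRegularityBounds_holds
    kangMiuraTsai_local_pressure_bound_holds

end Literature.Analysis.FluidPDE

end
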